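import Summits.QuantumFields.BalabanUV.Beta.AxialDressingRootedKernel

/-!
# The UNDRESSED, UN-GAUGE-FIXED bordered Hessian of the typed `U = 1` one-step system as a matrix kernel, file 1 of 2:
# `bhK N = [[d*d, −𝒬ᵀ_N], [+𝒬_N, 0]] : MKer (d+1) (Fib d)` — the candidate `𝕄₀` of the relative-inverse rules 3–4 at `j = 0`
# (β sub-cell, row BETA-an2, gen 13; AN2.md §38.8 item (1): «TYPE 𝕄₀ … as an `MKer 4 (Fib 3)` STATEMENT leaf»)

HONEST FRAMING (cell charter, verbatim): «discharging BetaPertH makes Balaban's UV stability UNCONDITIONAL — a real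
constructive-QFT result; it is NOT the continuum limit and NOT the Clay problem.»  DERIVED cell leaf (pub-balaban β sub-cell, lane
an2 gen 13); no statement of Bałaban's papers is typed here, no `[cite:]` tag, no `Prop` fact (`AgreeR` is a PREDICATE on two lattice
functions, asserted nowhere); it instantiates no binder of the β-function wall by itself.  NOT `BetaPertH`; NOT continuum; NOT Clay.

## What is here

The sockets `RelInv G_j 𝕄_j E` of the dressed spine's `hR` chain ask for a SPREAD kernel `𝕄_j` which the co-dressed step resolvent
`G_j` inverts on the range of the coordinate projector.  At `j = 0` the candidate is the bordered operator of the typed `U = 1`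
block-averaging KKT system WITHOUT its gauge-fixing rows and columns, packed on the fibre `Fib d = Fin (d+1) ⊕ Fin (d+1)` exactly as the
resolvent `OneStepResolventKernel.KInv` is (multiplier legs at the coarse points `N • y′`):
* §1 a real-valued AGREEMENT calculus (`AgreeR`, radius bookkeeping for `curv`, `curvAdj`; the `ℂ`-valued twin is
  `BlochFibreMatrix.Agree`) — LOCALITY of `d*d` with radius `2` (`curvAdj_curv_congr`);
* §2 **`bhK N`**: field–field entry `[y − x ∈ cube 2]·(d*d δ_{(l,y)})_κ(x)` (the window is the locality radius of `d*d`), field–multiplier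
  entry `−[proj N y = 0]·(𝒬ᵀ_N δ_{(l, quo N y)})_κ(x)`, multiplier–field entry `[proj N x = 0]·(𝒬_N δ_{(l,y)})_κ(quo N x)`, multiplier–
  multiplier entry `0` — the signs of the typed (EL) row `d*d A = 𝒬ᵀφ + dδdμ + F` of `KKTFluctuationUnique.SolvesKKT` and of the
  packing of `KInv` (`ℋ` = response to a PRESCRIBED block average); entries, multiplier rows / columns off the coarse sites vanish,
  uniform bound `abs_bhK_le`, finite range (`contourSumAdj_delta_ne_zero`, `contourSum_delta_ne_zero`, `bhK_eq_zero_of_not_mem_cube`),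
  `decays_bhK` (every rate), **`spr_bhK`**.
File 2 (`BorderedHessianKernelAction`): representation of `d*d`, `𝒬ᵀ_N`, `𝒬_N` by the entries and the ACTION LEMMAS `comp (bhK N) X`.

All declarations `[folklore]` (finite sums, support bookkeeping); axioms standard.
Provenance: b2b-balaban β sub-cell, unit beta-an2 gen 13, 2026-08-20 (v1); over `AffineAveraging` / `AffineReproduction` / `KKTFluctuationKernel` /
`KKTFluctuationEnergy` / `ResolventComposition` / `AxialDressingRooted(Kernel)` / `TameKernelCalculus` BY NAME; no existing file touched.
-/
open Finset
open scoped BigOperators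
open Literature.Probability.LatticeModels (TorusSite Torus.proj Torus.proj_apply)
open Literature.MathematicalPhysics.QuantumFieldTheory
open Literature.MathematicalPhysics.QuantumFieldTheory.Balaban1983to89
open Literature.MathematicalPhysics.QuantumFieldTheory.Balaban1983to89.Beta
open B12Sec2to5 (l1 l1_nonneg)
open ExpKernelCalculus (MKer Decays BiLoc comp tr shiftK)
open AffineAveraging (Form0 Form1 Form2 box toSite unitVec unitVec_apply dz curv curvAdj codiff₁ contourSum)
open AffineReproduction (contourSumAdj)
open LatticeForm (quo)
open KKTFluctuationKernel (delta1 delta1_apply)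
open KKTFluctuationEnergy (contourSumAdj_eq abs_curv_le abs_contourSumAdj_le)
open KernelSpecInstance (opEL curv_add curv_smul curvAdj_add curvAdj_smul)
open OneStepResolventKernel (Fib quo_zsmul eq_zsmul_quo_of_proj proj_zsmul)
open AxialProjector (zsmul_blk_le lt_zsmul_blk_add)
open Summit.QuantumFields.BalabanUV.Beta.TameKernelCalculus
open Summit.QuantumFields.BalabanUV.Beta.AxialDressingRooted (cube mem_cube zero_mem_cube l1_le_of_mem_cube tsum_window)

namespace Summit.QuantumFields.BalabanUV.Beta.BorderedHessian

noncomputable section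

variable {D : ℕ}

/-! ## §1 Real-valued agreement calculus: locality of `d*d` with radius `2` -/

section Agree

/-- [folklore] Agreement of two real 0-forms on the cube of radius `r` around `x`. -/
def AgreeR (r : ℕ) (f g : Form0 D ℝ) (x : Fin D → ℤ) : Prop :=
  ∀ t : Fin D → ℤ, (∀ j, -(r : ℤ) ≤ t j ∧ t j ≤ r) → f (x + t) = g (x + t)

/-- [folklore] Agreement at the centre. -/
theorem AgreeR.self {r : ℕ} {f g : Form0 D ℝ} {x : Fin D → ℤ} (h : AgreeR r f g x) : f x = g x := by
  have := h 0 (fun j => by simp)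
  simpa using this

/-- [folklore] Agreement on a smaller cube. -/
theorem AgreeR.mono {r : ℕ} {f g : Form0 D ℝ} {x : Fin D → ℤ} (h : AgreeR (r + 1) f g x) : AgreeR r f g x := by
  intro t ht
  exact h t (fun j => by have := ht j; push_cast; omega)

/-- [folklore] Agreement around the forward neighbour, radius one less. -/
theorem AgreeR.add_unitVec {r : ℕ} {f g : Form0 D ℝ} {x : Fin D → ℤ} (h : AgreeR (r + 1) f g x) (κ : Fin D) :
    AgreeR r f g (x + unitVec κ) := by
  intro t ht
  have hb : ∀ j, -((r + 1 : ℕ) : ℤ) ≤ (t + unitVec κ) j ∧ (t + unitVec κ) j ≤ ((r + 1 : ℕ) : ℤ) := by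
    intro j
    have := ht j
    simp only [Pi.add_apply, unitVec_apply]
    split_ifs <;> push_cast <;> omega
  have := h (t + unitVec κ) hb
  rwa [show x + (t + unitVec κ) = x + unitVec κ + t by abel] at this

/-- [folklore] Agreement around the backward neighbour, radius one less. -/
theorem AgreeR.sub_unitVec {r : ℕ} {f g : Form0 D ℝ} {x : Fin D → ℤ} (h : AgreeR (r + 1) f g x) (κ : Fin D) :
    AgreeR r f g (x - unitVec κ) := by
  intro t ht
  have hb : ∀ j, -((r + 1 : ℕ) : ℤ) ≤ (t - unitVec κ) j ∧ (t - unitVec κ) j ≤ ((r + 1 : ℕ) : ℤ) := by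
    intro j
    have := ht j
    simp only [Pi.sub_apply, unitVec_apply]
    split_ifs <;> push_cast <;> omega
  have := h (t - unitVec κ) hb
  rwa [show x + (t - unitVec κ) = x - unitVec κ + t by abel] at this

/-- [folklore] `curv` lowers the agreement radius by one. -/
theorem agreeR_curv {r : ℕ} {A B : Form1 D ℝ} {x : Fin D → ℤ} (h : ∀ l, AgreeR (r + 1) (A l) (B l) x) (κ l : Fin D) :
    AgreeR r (curv A κ l) (curv B κ l) x := by
  intro t ht
  simp only [curv]
  rw [show x + t + unitVec κ = x + unitVec κ + t by abel, show x + t + unitVec l = x + unitVec l + t by abel,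
    (h κ).mono t ht, (h l).mono t ht, ((h l).add_unitVec κ) t ht, ((h κ).add_unitVec l) t ht]

/-- [folklore] `curvAdj` lowers the agreement radius by one. -/
theorem agreeR_curvAdj {r : ℕ} {F G : Form2 D ℝ} {x : Fin D → ℤ} (h : ∀ κ l, AgreeR (r + 1) (F κ l) (G κ l) x)
    (μ : Fin D) : AgreeR r (curvAdj F μ) (curvAdj G μ) x := by
  intro t ht
  simp only [curvAdj]
  congr 1
  · refine Finset.sum_congr rfl (fun l _ => ?_)
    rw [show x + t - unitVec l = x - unitVec l + t by abel, (h μ l).mono t ht, ((h μ l).sub_unitVec l) t ht]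
  · refine Finset.sum_congr rfl (fun κ _ => ?_)
    rw [show x + t - unitVec κ = x - unitVec κ + t by abel, (h κ μ).mono t ht, ((h κ μ).sub_unitVec κ) t ht]

/-- [folklore] **LOCALITY OF `d*d` (radius `2`)**: two 1-forms agreeing on the window `x + cube 2` have the same `d*d` at `x`. -/
theorem curvAdj_curv_congr {A B : Form1 D ℝ} {x : Fin D → ℤ} (h : ∀ l, ∀ v ∈ cube D 2, A l (x + v) = B l (x + v))
    (μ : Fin D) : curvAdj (curv A) μ x = curvAdj (curv B) μ x := by
  have h2 : ∀ l, AgreeR 2 (A l) (B l) x := fun l t ht =>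
    h l t (mem_cube.2 fun j => by rw [abs_le]; exact_mod_cast ht j)
  have h1 : ∀ κ l, AgreeR 1 (curv A κ l) (curv B κ l) x := fun κ l => agreeR_curv h2 κ l
  exact (agreeR_curvAdj h1 μ).self

end Agree

/-! ## §2 The bordered Hessian kernel `bhK N` -/

section Def

variable {d : ℕ}

/-- [folklore] **THE UNDRESSED BORDERED HESSIAN KERNEL** `bhK N` of the typed `U = 1` one-step system (blocking `N`), packed on
`Fib d` with multiplier legs at the coarse points: `[[d*d, −𝒬ᵀ_N], [+𝒬_N, 0]]` read on indicator 1-forms.  The field–field entry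
carries the window `[y − x ∈ cube 2]` = the locality radius of `d*d` (harmless, `curvAdj_curv_eq_window_sum`). -/
def bhK (N : ℕ) : MKer (d + 1) (Fib d) :=
  fun x y a b =>
    match a, b with
    | Sum.inl κ, Sum.inl l => if y - x ∈ cube (d + 1) 2 then curvAdj (curv (delta1 l y)) κ x else 0
    | Sum.inl κ, Sum.inr l => if Torus.proj N y = 0 then -(contourSumAdj N (delta1 l (quo N y)) κ x) else 0
    | Sum.inr κ, Sum.inl l => if Torus.proj N x = 0 then contourSum N (delta1 l y) κ (quo N x) else 0
    | Sum.inr _, Sum.inr _ => 0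

variable (N : ℕ)

/-- [folklore] Field–field entry of `bhK`: the windowed matrix of `d*d`. -/
theorem bhK_inl_inl (x y : Fin (d + 1) → ℤ) (κ l : Fin (d + 1)) :
    bhK N x y (Sum.inl κ) (Sum.inl l) = if y - x ∈ cube (d + 1) 2 then curvAdj (curv (delta1 l y)) κ x else 0 := rfl

/-- [folklore] Field–multiplier entry of `bhK`: `−𝒬ᵀ_N` at the coarse points. -/
theorem bhK_inl_inr (x y : Fin (d + 1) → ℤ) (κ l : Fin (d + 1)) :
    bhK N x y (Sum.inl κ) (Sum.inr l) = if Torus.proj N y = 0 then -(contourSumAdj N (delta1 l (quo N y)) κ x) else 0 := rfl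

/-- [folklore] Multiplier–field entry of `bhK`: `+𝒬_N` at the coarse points. -/
theorem bhK_inr_inl (x y : Fin (d + 1) → ℤ) (κ l : Fin (d + 1)) :
    bhK N x y (Sum.inr κ) (Sum.inl l) = if Torus.proj N x = 0 then contourSum N (delta1 l y) κ (quo N x) else 0 := rfl

/-- [folklore] Multiplier–multiplier entry of `bhK` vanishes (no gauge-fixing block, no `𝒮`). -/
theorem bhK_inr_inr (x y : Fin (d + 1) → ℤ) (κ l : Fin (d + 1)) : bhK N x y (Sum.inr κ) (Sum.inr l) = 0 := rfl

/-- [folklore] Multiplier ROWS of `bhK` vanish off the coarse sublattice. -/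
theorem bhK_inr_row_off {x : Fin (d + 1) → ℤ} (hx : Torus.proj N x ≠ 0) (y : Fin (d + 1) → ℤ) (κ : Fin (d + 1)) (b : Fib d) :
    bhK N x y (Sum.inr κ) b = 0 := by
  rcases b with l | l
  · rw [bhK_inr_inl, if_neg hx]
  · rfl

/-- [folklore] Multiplier COLUMNS of `bhK` vanish off the coarse sublattice. -/
theorem bhK_inr_col_off {y : Fin (d + 1) → ℤ} (hy : Torus.proj N y ≠ 0) (x : Fin (d + 1) → ℤ) (a : Fib d) (l : Fin (d + 1)) :
    bhK N x y a (Sum.inr l) = 0 := by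
  rcases a with κ | κ
  · rw [bhK_inl_inr, if_neg hy]
  · rfl

/-- [folklore] Indicator 1-forms are bounded by `1`. -/
theorem abs_delta1_le (l : Fin (d + 1)) (y : Fin (d + 1) → ℤ) (κ : Fin (d + 1)) (x : Fin (d + 1) → ℤ) :
    |delta1 l y κ x| ≤ 1 := by
  rw [delta1_apply]
  split_ifs <;> simp

/-- [folklore] `|𝒬_N δ| ≤ N^{d+1} · N`. -/
theorem abs_contourSum_delta_le (l : Fin (d + 1)) (y : Fin (d + 1) → ℤ) (κ : Fin (d + 1)) (q : Fin (d + 1) → ℤ) :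
    |contourSum N (delta1 l y) κ q| ≤ (N : ℝ) ^ (d + 1) * N := by
  unfold AffineAveraging.contourSum
  have hcard : (box (d + 1) N).card = N ^ (d + 1) := by
    simp only [AffineAveraging.box, Fintype.card_piFinset, Finset.card_range, Finset.prod_const, Finset.card_univ, Fintype.card_fin]
  calc |∑ b ∈ box (d + 1) N, ∑ s ∈ Finset.range N, delta1 l y κ ((N : ℤ) • q + toSite b + (s : ℤ) • unitVec κ)|
      ≤ ∑ b ∈ box (d + 1) N, |∑ s ∈ Finset.range N, delta1 l y κ ((N : ℤ) • q + toSite b + (s : ℤ) • unitVec κ)| :=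
        Finset.abs_sum_le_sum_abs _ _
    _ ≤ ∑ b ∈ box (d + 1) N, ∑ s ∈ Finset.range N, |delta1 l y κ ((N : ℤ) • q + toSite b + (s : ℤ) • unitVec κ)| :=
        Finset.sum_le_sum fun b _ => Finset.abs_sum_le_sum_abs _ _
    _ ≤ ∑ _b ∈ box (d + 1) N, ∑ _s ∈ Finset.range N, (1 : ℝ) :=
        Finset.sum_le_sum fun b _ => Finset.sum_le_sum fun s _ => abs_delta1_le l y κ _
    _ = (N : ℝ) ^ (d + 1) * N := by
        rw [Finset.sum_const, Finset.sum_const, Finset.card_range, hcard]; simp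

/-- [folklore] The uniform entry bound of `bhK N`. -/
def cBH (d N : ℕ) : ℝ := ((d : ℝ) + 1) * 16 + N + (N : ℝ) ^ (d + 1) * N

/-- [folklore] `0 ≤ cBH`. -/
theorem cBH_nonneg (d N : ℕ) : 0 ≤ cBH d N := by unfold cBH; positivity

/-- [folklore] Every entry of `bhK N` is bounded by `cBH d N`. -/
theorem abs_bhK_le (x y : Fin (d + 1) → ℤ) (a b : Fib d) : |bhK N x y a b| ≤ cBH d N := by
  have h0 : (0 : ℝ) ≤ ((d : ℝ) + 1) * 16 := by positivity
  have hN : (0 : ℝ) ≤ N := by positivity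
  have hNN : (0 : ℝ) ≤ (N : ℝ) ^ (d + 1) * N := by positivity
  rcases a with κ | κ <;> rcases b with l | l
  · rw [bhK_inl_inl]
    split_ifs
    · have hc : ∀ κ' l' z, |curv (delta1 l y) κ' l' z| ≤ 4 * 1 := fun κ' l' z => abs_curv_le (abs_delta1_le l y) κ' l' z
      have h := ResolventComposition.abs_curvAdj_le hc κ x
      have e : ((d + 1 : ℕ) : ℝ) * (2 * (4 * 1)) + ((d + 1 : ℕ) : ℝ) * (2 * (4 * 1)) = ((d : ℝ) + 1) * 16 := by push_cast; ring
      rw [e] at h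
      unfold cBH; linarith
    · rw [abs_zero]; exact cBH_nonneg d N
  · rw [bhK_inl_inr]
    split_ifs
    · rw [abs_neg]
      have h := abs_contourSumAdj_le (N := N) (abs_delta1_le l (quo N y)) κ x
      rw [mul_one] at h
      unfold cBH; linarith
    · rw [abs_zero]; exact cBH_nonneg d N
  · rw [bhK_inr_inl]
    split_ifs
    · have h := abs_contourSum_delta_le N l y κ (quo N x)
      unfold cBH; linarith
    · rw [abs_zero]; exact cBH_nonneg d N
  · rw [bhK_inr_inr, abs_zero]; exact cBH_nonneg d N

/-- [folklore] `quo N x = blk N x` (both are the coordinatewise floor quotient). -/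
theorem quo_eq_blk (x : Fin (d + 1) → ℤ) : quo N x = AveragingContours.blk N x := rfl

/-- [folklore] SUPPORT OF THE `𝒬ᵀ` ENTRY: `(𝒬ᵀ_N δ_{(l, quo y)})_κ(x) ≠ 0` for a coarse `y` forces `y − x ∈ cube (2N)`. -/
theorem contourSumAdj_delta_ne_zero {N : ℕ} (hN : 1 ≤ N) {x y : Fin (d + 1) → ℤ} (hy : Torus.proj N y = 0) {κ l : Fin (d + 1)}
    (h : contourSumAdj N (delta1 l (quo N y)) κ x ≠ 0) : y - x ∈ cube (d + 1) (2 * N) := by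
  rw [contourSumAdj_eq] at h
  obtain ⟨s, hs, hne⟩ := Finset.exists_ne_zero_of_sum_ne_zero h
  rw [delta1_apply] at hne
  split_ifs at hne with hc
  · obtain ⟨-, hq⟩ := hc
    have hs' : s < N := Finset.mem_range.1 hs
    haveI : NeZero N := ⟨by omega⟩
    rw [mem_cube]
    intro i
    have hyq : y = (N : ℤ) • quo N y := eq_zsmul_quo_of_proj hy
    have a1 := zsmul_blk_le hN (x - (s : ℤ) • unitVec κ) i
    have a2 := lt_zsmul_blk_add hN (x - (s : ℤ) • unitVec κ) i
    rw [← quo_eq_blk, hq] at a1 a2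
    have hyi : y i = ((N : ℤ) • quo N y) i := congr_fun hyq i
    simp only [Pi.sub_apply, Pi.smul_apply, unitVec_apply, smul_eq_mul] at a1 a2 hyi ⊢
    rw [abs_le]
    have hsN : (s : ℤ) ≤ N - 1 := by omega
    have hs0 : (0 : ℤ) ≤ s := by positivity
    split_ifs at a1 a2 <;> push_cast <;> constructor <;> nlinarith
  · exact absurd rfl hne

/-- [folklore] SUPPORT OF THE `𝒬` ENTRY: `(𝒬_N δ_{(l,y)})_κ(quo x) ≠ 0` for a coarse `x` forces `y − x ∈ cube (2N)`. -/
theorem contourSum_delta_ne_zero {N : ℕ} (hN : 1 ≤ N) {x y : Fin (d + 1) → ℤ} (hx : Torus.proj N x = 0) {κ l : Fin (d + 1)}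
    (h : contourSum N (delta1 l y) κ (quo N x) ≠ 0) : y - x ∈ cube (d + 1) (2 * N) := by
  unfold AffineAveraging.contourSum at h
  obtain ⟨b, hb, hne⟩ := Finset.exists_ne_zero_of_sum_ne_zero h
  obtain ⟨s, hs, hne'⟩ := Finset.exists_ne_zero_of_sum_ne_zero hne
  rw [delta1_apply] at hne'
  split_ifs at hne' with hc
  · obtain ⟨-, hpt⟩ := hc
    have hs' : s < N := Finset.mem_range.1 hs
    haveI : NeZero N := ⟨by omega⟩
    have hb' : ∀ i, b i < N := fun i => Finset.mem_range.1 (Fintype.mem_piFinset.1 hb i)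
    have hxq : x = (N : ℤ) • quo N x := eq_zsmul_quo_of_proj hx
    rw [mem_cube]
    intro i
    have hpi := congr_fun hpt i
    have hxi : x i = ((N : ℤ) • quo N x) i := congr_fun hxq i
    simp only [Pi.add_apply, Pi.smul_apply, unitVec_apply, smul_eq_mul, toSite] at hpi hxi ⊢
    rw [abs_le]
    have hsN : (s : ℤ) ≤ N - 1 := by omega
    have hs0 : (0 : ℤ) ≤ s := by positivity
    have hbi : ((b i : ℕ) : ℤ) ≤ N - 1 := by have := hb' i; omega
    have hb0 : (0 : ℤ) ≤ (b i : ℕ) := by positivity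
    rw [Pi.sub_apply, ← hpi, hxi]
    split_ifs <;> push_cast <;> constructor <;> nlinarith
  · exact absurd rfl hne'

/-- [folklore] Small windows sit inside larger ones. -/
theorem cube_mono {n M M' : ℕ} (h : M ≤ M') {v : Fin n → ℤ} (hv : v ∈ cube n M) : v ∈ cube n M' := by
  rw [mem_cube] at hv ⊢
  intro i
  exact (hv i).trans (by exact_mod_cast h)

/-- [folklore] **FINITE RANGE**: `bhK N x y a b = 0` unless `y − x ∈ cube (2N)` (`N ≥ 1`). -/
theorem bhK_eq_zero_of_not_mem_cube {N : ℕ} (hN : 1 ≤ N) {x y : Fin (d + 1) → ℤ} (hxy : y - x ∉ cube (d + 1) (2 * N)) (a b : Fib d) :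
    bhK N x y a b = 0 := by
  rcases a with κ | κ <;> rcases b with l | l
  · rw [bhK_inl_inl, if_neg]
    exact fun h => hxy (cube_mono (by omega) h)
  · rw [bhK_inl_inr]
    split_ifs with hy
    · by_contra hne
      exact hxy (contourSumAdj_delta_ne_zero hN hy (fun h => hne (by rw [h, neg_zero])))
    · rfl
  · rw [bhK_inr_inl]
    split_ifs with hx
    · by_contra hne
      exact hxy (contourSum_delta_ne_zero hN hx hne)
    · rfl
  · rfl

/-- [folklore] **`bhK N` DECAYS AT EVERY RATE** (finite range `2N(d+1)` in `ℓ¹`, bounded entries). -/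
theorem decays_bhK {N : ℕ} (hN : 1 ≤ N) {δ : ℝ} (hδ : 0 ≤ δ) :
    Decays (bhK (d := d) N) (cBH d N * Real.exp (δ * (((d : ℝ) + 1) * (2 * N)))) δ := by
  intro x y a b
  by_cases hxy : y - x ∈ cube (d + 1) (2 * N)
  · have hl : l1 (x - y) ≤ ((d : ℝ) + 1) * (2 * N) := by
      rw [ExpKernelCalculus.l1_sub_symm]
      have := l1_le_of_mem_cube hxy
      push_cast at this
      linarith
    calc |bhK N x y a b| ≤ cBH d N * 1 := by rw [mul_one]; exact abs_bhK_le N x y a b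
      _ ≤ cBH d N * (Real.exp (δ * (((d : ℝ) + 1) * (2 * N))) * Real.exp (-δ * l1 (x - y))) := by
          refine mul_le_mul_of_nonneg_left ?_ (cBH_nonneg d N)
          rw [← Real.exp_add]
          exact Real.one_le_exp (by nlinarith)
      _ = cBH d N * Real.exp (δ * (((d : ℝ) + 1) * (2 * N))) * Real.exp (-δ * l1 (x - y)) := by ring
  · rw [bhK_eq_zero_of_not_mem_cube hN hxy, abs_zero]
    exact mul_nonneg (mul_nonneg (cBH_nonneg d N) (Real.exp_pos _).le) (Real.exp_pos _).le

/-- [folklore] **`bhK N` IS SPREAD** (`N ≥ 1`). -/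
theorem spr_bhK {N : ℕ} (hN : 1 ≤ N) : Spr (bhK (d := d) N) :=
  ⟨_, 1, one_pos, decays_bhK hN zero_le_one⟩

end Def
end

end Summit.QuantumFields.BalabanUV.Beta.BorderedHessian
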